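import Summits.CriticalPhenomena.PercolationContinuityZ3.Theorems.PercNearOneGluingNoHeavyQuantHeavySingleTools
import HarnessLib

/-!
# QUANT lane R8, T-DEC: THE ORACLE-MIXTURE INTERFACE — a forest whose law is an exact mixture of tree-built laws with fewer gates, the
# forest's mean and floors at least the forest's, is SDEC given the oracle (the common-target RCM certificate, k-general; arm-1 gen 53)

builds on p205010 (kernel theorem, internal audit signed; external expert review pending)

Support file (`--supports stmt-CriticalPhenomena-4575`), QUANT lane seat prim-quant-arm-1 (gen 53, architect); memo
`run/shared/lean/prim/quant/prim-quant-arm-1-g53/ARCH-G53.md` §2e.  Theorems only, standard axioms, no sorries.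

WHY.  Every certificate of this generation (`…QuantHeavySingleStep/Mixture/ProductMix`, `…QuantSymTriple/TrueFloor`, `…QuantSymForest`) and lead
g42's numerical RCM ("re-parenting count mixtures", README V394: 0 / ≈11 500 failures) have ONE shape: the forest law `flaw L` is an EXACT finite mixture
`Σ_c λ_c F_c` of laws `F_c` that are tree-built with FEWER nontrivial gates than the forest (so the induction hypothesis = oracle makes them SDEC), at
floors `y_c` at least the forest's floor `x`, each with mean EXACTLY `fmean L` (the common target).  Then for every outer gate `a`,
`gate_a(flaw L) = Σ_c λ_c gate_a(F_c)` and each `gate_a(F_c)` is DEC at every layer at the target `a·fmean L` (`decAtT_gate_of_sdec`), so the mixture is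
(`decAtT_mixture_finset`).  This file states that once, as the kernel interface for census-found certificates:
**`sdec_flaw_of_oracleMixture`** (list form) and `decAt_gate_of_oracleMixture` (outer-gate form).  Components may have smaller tops (`M_c ≤ ftop L`,
`decAtT_mono_top`).  What is NOT covered: components whose mean differs from `fmean L` (then re-gate to the common mean — typer g39's
`decAt_gate_of_regate₀` — or no common-target certificate exists: `…QuantHeavySingleMomentBound`, memo §2c).

HONEST STATUS: an interface; `SiblingStep`, `GateStepN`, `LightResidDECOracle`, `FarTreeRow` OPEN; RATE class (log\*) / honest sentence of
`run/shared/lean/prim/quant/README.md` unchanged.  [this work].  Nothing here is cited as a published result.  The gluing rows served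
[cite: KozmaNitzan2024, Conjecture 3 (p. 15)]; product measure [cite: Grimmett1999, §1.3 p. 10].
-/

noncomputable section

open scoped BigOperators

namespace Summit.CriticalPhenomena.PercolationContinuityZ3.Theorems
namespace Quant
namespace LawDec

open Finset

/-- **THE ORACLE-MIXTURE CERTIFICATE (outer-gate form).**  A probability law `μ` on `{0..M}` with mean `T` that is an exact finite mixture
`μ = Σ_c λ_c F_c` (`λ ≥ 0`, `Σλ = 1`) of laws `F_c` on `{0..M_c}`, `M_c ≤ M`, each tree-built at a floor `y_c ≥ x` with a gate count `n_c` served by the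
oracle, and each of mean exactly `T`: then `gate μ a` is DEC at floor `a·x` with target `a·T` at every layer. [this work] -/
theorem decAtT_gate_of_oracleMixture {x a T : ℝ} {M : ℕ} (μ : ℕ → ℝ) (ha0 : 0 < a) (ha1 : a ≤ 1)
    {N : ℕ} (hO : ∀ (x' : ℝ) (n' M' : ℕ) (μ' : ℕ → ℝ), n' < N → TreeBuiltN x' n' M' μ' → SDEC x' M' μ')
    {C : Type*} [Fintype C] (lam : C → ℝ) (F : C → ℕ → ℝ) (y : C → ℝ) (n Mc : C → ℕ)
    (hlam0 : ∀ c, 0 ≤ lam c) (hlam1 : ∑ c, lam c = 1)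
    (hF : ∀ c, 0 < lam c → TreeBuiltN (y c) (n c) (Mc c) (F c) ∧ n c < N ∧ x ≤ y c ∧ Mc c ≤ M ∧
      ∑ h ∈ Finset.range (Mc c + 1), (h : ℝ) * F c h = T)
    (hmix : ∀ h, μ h = ∑ c, lam c * F c h) (j : ℕ) :
    DECAtT (a * x) (a * T) j M (gate μ a) := by
  classical
  have e : gate μ a = fun h => ∑ c ∈ (Finset.univ : Finset C), lam c * gate (F c) a h := by
    funext h
    rw [show μ = fun k => ∑ c ∈ (Finset.univ : Finset C), lam c * F c k from funext hmix, gate_fsum_mix _ _ _ _ hlam1]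
  rw [e]
  refine decAtT_mixture_finset Finset.univ lam _ (fun c _ => hlam0 c) hlam1 fun c _ hc => ?_
  obtain ⟨hT, hn, hxy, hM, hmean⟩ := hF c hc
  obtain ⟨hy0, hy1, F0, FM, F1, Fta⟩ := hT.lawFacts
  have hS : SDEC (y c) (Mc c) (F c) := hO _ _ _ _ hn hT
  have d := decAtT_gate_of_sdec (Mc c) (F c) (y c) a (a * x) hy0.le ha0 ha1 (mul_lt_one_aux ha1 hy0.le hy1)
    (mul_le_mul_of_nonneg_left hxy ha0.le) F0 FM F1 Fta hS j
  rw [hmean] at d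
  exact decAtT_mono_top d hM

/-- **THE ORACLE-MIXTURE CERTIFICATE FOR A FOREST (the common-target RCM interface, list form).**  Floor `0 < x < 1`, a list `L` of tree-built
siblings, the oracle below `fgates L`; a finite family of laws `F_c` with weights `λ_c ≥ 0`, `Σλ = 1`, each genuine `F_c` tree-built (`TreeBuiltN (y c)
(n c) (Mc c) (F c)`) with `n c < fgates L`, floor `x ≤ y c`, top `Mc c ≤ ftop L` and mean EXACTLY `fmean L`; and the exact identity
`flaw L = Σ_c λ_c F_c`.  THEN `SDEC x (ftop L) (flaw L)` (the floor bounds `0 < x < 1` are implied by the components'). [this work] -/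
theorem sdec_flaw_of_oracleMixture {x : ℝ} (L : List Sib) (hL : ∀ t ∈ L, t.TreeOK x)
    (hO : ∀ (x' : ℝ) (n' M' : ℕ) (μ' : ℕ → ℝ), n' < fgates L → TreeBuiltN x' n' M' μ' → SDEC x' M' μ')
    {C : Type*} [Fintype C] (lam : C → ℝ) (F : C → ℕ → ℝ) (y : C → ℝ) (n Mc : C → ℕ)
    (hlam0 : ∀ c, 0 ≤ lam c) (hlam1 : ∑ c, lam c = 1)
    (hF : ∀ c, 0 < lam c → TreeBuiltN (y c) (n c) (Mc c) (F c) ∧ n c < fgates L ∧ x ≤ y c ∧ Mc c ≤ ftop L ∧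
      ∑ h ∈ Finset.range (Mc c + 1), (h : ℝ) * F c h = fmean L)
    (hmix : ∀ h, flaw L h = ∑ c, lam c * F c h) :
    SDEC x (ftop L) (flaw L) := by
  intro a ha0 ha1 j _
  obtain ⟨_, _, _, fmn⟩ := flaw_facts L (fun t ht => (hL t ht).lawOK)
  rw [decAt_iff_decAtT, sum_mul_gate, fmn]
  exact decAtT_gate_of_oracleMixture (flaw L) ha0 ha1 hO lam F y n Mc hlam0 hlam1 hF hmix j

end LawDec
end Quant
end Summit.CriticalPhenomena.PercolationContinuityZ3.Theorems
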